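import Summits.CriticalPhenomena.PercolationContinuityZ3.Theorems.SahiBoxTP2Split

/-!
# Maps of the unit cube that are monotone on almost every pair have monotone Borel versions

Cell `prim-sahi`, typer (generation 17); `--supports stmt-CriticalPhenomena-4575`.  Theorems only (no definitions,
no named facts, no sorries).

Let `λ_d` be Lebesgue measure on `Q_d = (Fin d → [0,1])`.  A measurable `g : Q_d → [0,1]` is *monotone on almost
every pair* if `x ≤ y ⇒ g x ≤ g y` off a `λ_d ⊗ λ_d`-null set of pairs — the form of monotonicity that the standard
construction produces from a law that is conditionally increasing in sequence in the a.e.-kernel sense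
(`SahiCISCoupling.lean`).  It is weaker than "monotone on a set of full measure" (pairs sharing a coordinate are
`λ_d ⊗ λ_d`-null but need not be controlled), so the envelope lemma `exists_monotone_ae_eq_of_monotoneOn` of
`SahiBoxTP2Positivity.lean` does not apply.  Nevertheless:

* `exists_monotone_ae_eq_of_aepair` — **every measurable `g : Q_d → [0,1]` monotone on almost every pair is
  `λ_d`-a.e. equal to a MONOTONE BOREL `g' : Q_d → [0,1]`** — the lower essential envelope
  `g'(u) = sup{q ∈ ℚ : λ_d({g > q} ∩ [0,u]) > 0}`.  That `g' ≥ g` a.e. is Lebesgue's density theorem on the cube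
  (Besicovitch form, `SahiBoxTP2Split.instHasBesicovitchCoveringCube`): at a density point `u` of `{g > q}` the lower
  box `[u − r, u]`, a `2^{−d}` fraction of the sup-ball `B̄(u,r)`, meets `{g > q}` in positive measure
  (`ae_measure_inter_Iic_pos`); that `g' ≤ g` a.e. is Fubini on the pair hypothesis.
* `exists_monotone_ae_eq_of_aepair_pi` — the same for maps `Q_d → Q_d` (coordinatewise), so a push-forward
  `G_* λ_d` by an a.e.-pair-monotone Borel `G` is the push-forward by a monotone Borel map
  (`exists_monotone_map_eq_of_aepair`).
Auxiliary: volumes of boxes and sup-balls of `Q_d` (`volume_Icc_cube`, `volume_closedBall_cube_le`,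
`volume_lowerBox`), and `ae_forall_coord_pos` (a.e. point of the cube has positive coordinates).

References (the density theorem): Mathlib `Besicovitch.ae_tendsto_measure_inter_div_of_measurableSet`;
Federer, *Geometric Measure Theory* 2.9.11. [folklore]  The envelope statement on the cube is this work.
-/

noncomputable section

namespace Summit.CriticalPhenomena.PercolationContinuityZ3.Theorems.SahiCIS

open MeasureTheory Set Filter Topology Metric Function
open Summit.CriticalPhenomena.PercolationContinuityZ3.Theorems.SahiBoxTP2
open scoped ENNReal unitInterval NNReal

variable {d : ℕ}

/-! ### Volumes of boxes and balls of the cube -/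

section Volumes

/-- Volume of a coordinate box of `Q_d`: `λ_d([a,b]) = ∏_i (b_i − a_i)`. [folklore] -/
theorem volume_Icc_cube (a b : Fin d → I) :
    (volume : Measure (Fin d → I)) (Icc a b) = ∏ i, ENNReal.ofReal ((b i : ℝ) - a i) := by
  rw [volume_pi, ← Set.pi_univ_Icc, Measure.pi_pi]
  simp only [unitInterval.volume_Icc]

/-- The closed sup-ball of radius `h ≥ 0` of `Q_d` has volume at most `(2h)^d`. [folklore] -/
theorem volume_closedBall_cube_le (x : Fin d → I) {h : ℝ} (hh : 0 ≤ h) :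
    (volume : Measure (Fin d → I)) (closedBall x h) ≤ ENNReal.ofReal ((2 * h) ^ d) := by
  rw [closedBall_eq_Icc x hh, volume_Icc_cube, ← Fin.prod_const, ENNReal.ofReal_prod_of_nonneg
    (fun _ _ => by positivity)]
  refine Finset.prod_le_prod' fun i _ => ENNReal.ofReal_le_ofReal ?_
  simp only [hiCorner, loCorner, coe_projIcc]
  have h0 := (x i).2.1; have h1 := (x i).2.2
  have e1 : max (0 : ℝ) (min 1 ((x i : ℝ) + h)) ≤ (x i : ℝ) + h :=
    max_le (by linarith) (min_le_right _ _)
  have e2 : (x i : ℝ) - h ≤ max (0 : ℝ) (min 1 ((x i : ℝ) - h)) :=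
    le_max_of_le_right (le_min (by linarith) le_rfl)
  linarith

/-- If `h ≤ x_i` for all `i`, the lower corner of the ball is `x − h` exactly. [folklore] -/
theorem coe_loCorner_of_le (x : Fin d → I) {h : ℝ} (hh : 0 ≤ h) (hx : ∀ i, h ≤ (x i : ℝ)) (i : Fin d) :
    (loCorner x h i : ℝ) = (x i : ℝ) - h := by
  simp only [loCorner, coe_projIcc]
  have h1 := (x i).2.2
  rw [min_eq_right (by linarith), max_eq_right (by linarith [hx i])]

/-- The lower box `[x − h, x]` (for `h ≤ x_i`) has volume `h^d`. [folklore] -/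
theorem volume_lowerBox (x : Fin d → I) {h : ℝ} (hh : 0 ≤ h) (hx : ∀ i, h ≤ (x i : ℝ)) :
    (volume : Measure (Fin d → I)) (Icc (loCorner x h) x) = ENNReal.ofReal (h ^ d) := by
  rw [volume_Icc_cube, ← Fin.prod_const, ENNReal.ofReal_prod_of_nonneg (fun _ _ => hh)]
  refine Finset.prod_congr rfl fun i _ => ?_
  rw [coe_loCorner_of_le x hh hx i]; ring_nf

/-- The lower box lies in the closed sup-ball. [folklore] -/
theorem lowerBox_subset_closedBall (x : Fin d → I) {h : ℝ} (hh : 0 ≤ h) :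
    Icc (loCorner x h) x ⊆ closedBall x h := by
  rw [closedBall_eq_Icc x hh]
  exact Icc_subset_Icc_right fun i => by
    change (x i : ℝ) ≤ (projIcc 0 1 zero_le_one ((x i : ℝ) + h) : ℝ)
    rw [coe_projIcc]
    have h1 := (x i).2.2; have h0 := (x i).2.1
    exact le_max_of_le_right (le_min h1 (by linarith))

/-- `2^d · λ(lower box) ≥ λ(ball)`, in the form `(2⁻¹)^d λ(B̄(x,h)) ≤ λ([x−h,x])`. [folklore] -/
theorem half_pow_mul_volume_closedBall_le (x : Fin d → I) {h : ℝ} (hh : 0 ≤ h) (hx : ∀ i, h ≤ (x i : ℝ)) :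
    (2⁻¹ : ℝ≥0∞) ^ d * (volume : Measure (Fin d → I)) (closedBall x h) ≤
      (volume : Measure (Fin d → I)) (Icc (loCorner x h) x) := by
  rw [volume_lowerBox x hh hx]
  calc (2⁻¹ : ℝ≥0∞) ^ d * volume (closedBall x h)
      ≤ (2⁻¹ : ℝ≥0∞) ^ d * ENNReal.ofReal ((2 * h) ^ d) := by
        gcongr; exact volume_closedBall_cube_le x hh
    _ = ENNReal.ofReal (h ^ d) := by
        rw [mul_pow, ENNReal.ofReal_mul (by positivity), ← mul_assoc, ENNReal.ofReal_pow (by norm_num),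
          ← mul_pow, ENNReal.ofReal_ofNat, ENNReal.inv_mul_cancel (by norm_num) (by norm_num), one_pow, one_mul]

end Volumes

/-! ### Almost every point of the cube: positive coordinates, density points -/

section Density

/-- Almost every point of `Q_d` has all coordinates positive. [folklore] -/
theorem ae_forall_coord_pos : ∀ᵐ u ∂(volume : Measure (Fin d → I)), ∀ i, 0 < (u i : ℝ) := by
  rw [ae_all_iff]
  intro i
  rw [ae_iff]
  have hset : {u : Fin d → I | ¬ 0 < (u i : ℝ)} = Function.eval i ⁻¹' {⊥} := by
    ext u
    simp only [mem_setOf_eq, not_lt, mem_preimage, mem_singleton_iff]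
    constructor
    · intro h; exact le_bot_iff.1 (Subtype.coe_le_coe.1 (h.trans (le_of_eq rfl)))
    · intro h
      have h' : u i = ⊥ := h
      rw [h', Set.Icc.coe_bot]
  rw [hset, volume_pi, Measure.pi_eval_preimage_null]
  exact measure_singleton _

/-- The measurable set of pairs `{(u, v) : v ∈ L, v ≤ u}`. [folklore] -/
theorem measurableSet_pairs_below {L : Set (Fin d → I)} (hL : MeasurableSet L) :
    MeasurableSet {p : (Fin d → I) × (Fin d → I) | p.2 ∈ L ∧ p.2 ≤ p.1} :=
  (measurable_snd hL).inter (measurableSet_le measurable_snd measurable_fst)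

/-- `u ↦ λ_d(L ∩ [0,u])` is measurable. [folklore] -/
theorem measurable_measure_inter_Iic {L : Set (Fin d → I)} (hL : MeasurableSet L) :
    Measurable fun u : Fin d → I => (volume : Measure (Fin d → I)) (L ∩ Iic u) := by
  have hF : Measurable fun p : (Fin d → I) × (Fin d → I) =>
      ({p : (Fin d → I) × (Fin d → I) | p.2 ∈ L ∧ p.2 ≤ p.1}).indicator
        (1 : (Fin d → I) × (Fin d → I) → ℝ≥0∞) p :=
    (@measurable_const ℝ≥0∞ _ _ _ 1).indicator (measurableSet_pairs_below hL)
  have h : Measurable fun u : Fin d → I => ∫⁻ v, ({p : (Fin d → I) × (Fin d → I) | p.2 ∈ L ∧ p.2 ≤ p.1}).indicator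
      (1 : (Fin d → I) × (Fin d → I) → ℝ≥0∞) (u, v) ∂(volume : Measure (Fin d → I)) :=
    hF.lintegral_prod_right'
  convert h using 1
  funext u
  rw [← lintegral_indicator_one (hL.inter measurableSet_Iic)]
  exact lintegral_congr fun v => rfl

/-- Measurability of `{u : λ_d(L ∩ [0,u]) > 0}`. [folklore] -/
theorem measurableSet_measure_inter_Iic_pos {L : Set (Fin d → I)} (hL : MeasurableSet L) :
    MeasurableSet {u : Fin d → I | 0 < (volume : Measure (Fin d → I)) (L ∩ Iic u)} :=
  measurableSet_lt measurable_const (measurable_measure_inter_Iic hL)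

/-- **Lebesgue density on the cube, lower-box form**: for a measurable `L ⊆ Q_d`, almost every `u ∈ L` has
`λ_d(L ∩ [0,u]) > 0`.  (At a density point with positive coordinates, the lower box `[u − r, u]` is a `2^{−d}`
fraction of the sup-ball `B̄(u,r)`, whose complement part in `L` is eventually smaller.) [folklore] -/
theorem ae_measure_inter_Iic_pos {L : Set (Fin d → I)} (hL : MeasurableSet L) :
    ∀ᵐ u ∂(volume : Measure (Fin d → I)), u ∈ L → 0 < (volume : Measure (Fin d → I)) (L ∩ Iic u) := by
  filter_upwards [Besicovitch.ae_tendsto_measure_inter_div_of_measurableSet (volume : Measure (Fin d → I)) hL,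
    ae_forall_coord_pos] with u hdens hpos huL
  rw [Set.indicator_of_mem huL, Pi.one_apply] at hdens
  set μ := (volume : Measure (Fin d → I)) with hμ
  set c : ℝ≥0∞ := 1 - (2⁻¹ : ℝ≥0∞) ^ d with hc
  have hhalf : (2⁻¹ : ℝ≥0∞) ^ d ≤ 1 := pow_le_one' (by norm_num) d
  have hc1 : c < 1 := by
    rw [hc]
    exact ENNReal.sub_lt_self ENNReal.one_ne_top one_ne_zero (pow_ne_zero _ (by norm_num))
  have hctop : c ≠ ⊤ := ne_top_of_lt hc1
  -- a radius `r` with `0 < r`, `r ≤ u_i` for all `i`, and density ratio `> c`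
  have hev1 : ∀ᶠ r in 𝓝[>] (0 : ℝ), c < μ (L ∩ closedBall u r) / μ (closedBall u r) :=
    hdens.eventually (lt_mem_nhds hc1)
  have hev2 : ∀ᶠ r in 𝓝[>] (0 : ℝ), ∀ i, r ≤ (u i : ℝ) := by
    refine eventually_nhdsWithin_of_eventually_nhds (Filter.eventually_all.2 fun i => ?_)
    exact (eventually_lt_nhds (hpos i)).mono fun r hr => hr.le
  have hev3 : ∀ᶠ r in 𝓝[>] (0 : ℝ), 0 < r := eventually_mem_nhdsWithin
  obtain ⟨r, hr1, hr2, hr3⟩ := (hev1.and (hev2.and hev3)).exists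
  have hr0 : 0 ≤ r := hr3.le
  set B := closedBall u r with hB
  set K := Icc (loCorner u r) u with hK
  have hKB : K ⊆ B := lowerBox_subset_closedBall u hr0
  have hBtop : μ B ≠ ⊤ := measure_ne_top _ _
  -- density: `c · μ B < μ (L ∩ B)`
  have h1 : c * μ B < μ (L ∩ B) :=
    (ENNReal.lt_div_iff_mul_lt (Or.inr hctop) (Or.inl hBtop)).1 hr1
  -- geometry: `(2⁻¹)^d μ B ≤ μ K`
  have h2 : (2⁻¹ : ℝ≥0∞) ^ d * μ B ≤ μ K := half_pow_mul_volume_closedBall_le u hr0 hr2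
  -- the target: `μ (L ∩ K) > 0`, and `L ∩ K ⊆ L ∩ Iic u`
  have hKsub : L ∩ K ⊆ L ∩ Iic u := inter_subset_inter_right _ fun v hv => hv.2
  refine lt_of_lt_of_le (pos_iff_ne_zero.2 fun h0 => ?_) (measure_mono hKsub)
  have h3 : μ K ≤ μ (L ∩ K) + μ (B \ L) := by
    calc μ K ≤ μ ((L ∩ K) ∪ (B \ L)) := measure_mono fun v hv => by
          by_cases hvL : v ∈ L
          · exact Or.inl ⟨hvL, hv⟩
          · exact Or.inr ⟨hKB hv, hvL⟩
      _ ≤ μ (L ∩ K) + μ (B \ L) := measure_union_le _ _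
  rw [h0, zero_add] at h3
  have h4 : μ (B ∩ L) + μ (B \ L) = μ B := measure_inter_add_sdiff B hL
  have h5 : c * μ B + (2⁻¹ : ℝ≥0∞) ^ d * μ B < μ (L ∩ B) + μ (B \ L) :=
    ENNReal.add_lt_add_of_lt_of_le (ne_top_of_le_ne_top hBtop ((h2.trans h3).trans (measure_mono Set.sdiff_subset)))
      h1 (h2.trans h3)
  rw [inter_comm L B, h4, ← add_mul, hc, tsub_add_cancel_of_le hhalf, one_mul] at h5
  exact lt_irrefl _ h5

end Density

/-! ### The monotone version -/

section Envelope

/-- Real rational thresholds clamped to `[0,1]`. [folklore] -/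
theorem projIcc_le_of_lt_coe {q : ℚ} {t : I} (h : (q : ℝ) < (t : ℝ)) : projIcc (0 : ℝ) 1 zero_le_one (q : ℝ) ≤ t := by
  have := monotone_projIcc (zero_le_one (α := ℝ)) h.le
  rwa [projIcc_val] at this

/-- **Monotone Borel version of a map monotone on almost every pair.** If `g : Q_d → [0,1]` is measurable and
`x ≤ y ⇒ g x ≤ g y` off a `λ_d ⊗ λ_d`-null set of pairs, then `g` agrees `λ_d`-a.e. with a monotone measurable
`g' : Q_d → [0,1]` — the lower essential envelope `g'(u) = sup {q ∈ ℚ : λ_d({g > q} ∩ [0,u]) > 0}`. [this work] -/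
theorem exists_monotone_ae_eq_of_aepair {g : (Fin d → I) → I} (hgm : Measurable g)
    (hg : ∀ᵐ p ∂((volume : Measure (Fin d → I)).prod volume), p.1 ≤ p.2 → g p.1 ≤ g p.2) :
    ∃ g' : (Fin d → I) → I, Monotone g' ∧ Measurable g' ∧ g' =ᵐ[volume] g := by
  set μ := (volume : Measure (Fin d → I)) with hμ
  -- super-level sets and the positivity predicate
  set L : ℚ → Set (Fin d → I) := fun q => {x | (q : ℝ) < (g x : ℝ)} with hL
  have hLm : ∀ q, MeasurableSet (L q) := fun q =>
    measurableSet_lt measurable_const (measurable_subtype_coe.comp hgm)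
  set P : ℚ → (Fin d → I) → Prop := fun q u => 0 < μ (L q ∩ Iic u) with hP
  have hPm : ∀ q, MeasurableSet {u | P q u} := fun q => measurableSet_measure_inter_Iic_pos (hLm q)
  have hPmono : ∀ q, ∀ ⦃u v : Fin d → I⦄, u ≤ v → P q u → P q v := fun q u v huv hu =>
    lt_of_lt_of_le hu (measure_mono (inter_subset_inter_right _ (Iic_subset_Iic.2 huv)))
  -- the envelope
  set g' : (Fin d → I) → I := fun u => ⨆ q : ℚ, if P q u then projIcc (0 : ℝ) 1 zero_le_one (q : ℝ) else ⊥
    with hg'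
  refine ⟨g', ?_, ?_, ?_⟩
  · -- monotone
    intro u v huv
    refine iSup_mono fun q => ?_
    by_cases hq : P q u
    · rw [if_pos hq, if_pos (hPmono q huv hq)]
    · rw [if_neg hq]; exact bot_le
  · -- measurable
    refine Measurable.iSup fun q => ?_
    exact Measurable.ite (hPm q) measurable_const measurable_const
  · -- a.e. equal
    -- (1) for a.e. `u`: a.e. `v ≤ u` has `g v ≤ g u`
    have hswap : ∀ᵐ p ∂(μ.prod μ), p.2 ≤ p.1 → g p.2 ≤ g p.1 := by
      have h := (ae_of_ae_map (μ := μ.prod μ) measurable_swap.aemeasurable (by rw [Measure.prod_swap]; exact hg))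
      filter_upwards [h] with p hp using hp
    have hbelow : ∀ᵐ u ∂μ, ∀ᵐ v ∂μ, v ≤ u → g v ≤ g u := Measure.ae_ae_of_ae_prod hswap
    -- (2) for a.e. `u`: density in every super-level set containing it
    have hdens : ∀ᵐ u ∂μ, ∀ q : ℚ, u ∈ L q → P q u := by
      rw [ae_all_iff]; intro q; exact ae_measure_inter_Iic_pos (hLm q)
    filter_upwards [hbelow, hdens] with u hu1 hu2
    -- key: `P q u ⇒ q < g u`
    have hkey : ∀ q : ℚ, P q u → (q : ℝ) < (g u : ℝ) := by
      intro q hq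
      by_contra hle
      rw [not_lt] at hle
      have hsub : L q ∩ Iic u ⊆ {v | ¬ (v ≤ u → g v ≤ g u)} := by
        rintro v ⟨hvq, hvu⟩ himp
        have : (g v : ℝ) ≤ (g u : ℝ) := Subtype.coe_le_coe.2 (himp hvu)
        exact absurd (lt_of_lt_of_le hvq (this.trans hle)) (lt_irrefl _)
      have h0 : μ (L q ∩ Iic u) = 0 := measure_mono_null hsub (ae_iff.1 hu1)
      exact absurd h0 hq.ne'
    apply le_antisymm
    · -- `g' u ≤ g u`
      refine iSup_le fun q => ?_
      by_cases hq : P q u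
      · rw [if_pos hq]; exact projIcc_le_of_lt_coe (hkey q hq)
      · rw [if_neg hq]; exact bot_le
    · -- `g u ≤ g' u`
      by_contra hlt
      rw [not_le] at hlt
      obtain ⟨q, hq1, hq2⟩ := exists_rat_btwn (Subtype.coe_lt_coe.2 hlt)
      have hPq : P q u := hu2 q hq2
      have hq0 : (0 : ℝ) ≤ q := (g' u).2.1.trans hq1.le
      have hq1' : (q : ℝ) ≤ 1 := hq2.le.trans (g u).2.2
      have hle : projIcc (0 : ℝ) 1 zero_le_one (q : ℝ) ≤ g' u := by
        have : (if P q u then projIcc (0 : ℝ) 1 zero_le_one (q : ℝ) else ⊥) ≤ g' u :=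
          le_iSup (fun q : ℚ => if P q u then projIcc (0 : ℝ) 1 zero_le_one (q : ℝ) else ⊥) q
        rwa [if_pos hPq] at this
      have hval : ((projIcc (0 : ℝ) 1 zero_le_one (q : ℝ) : I) : ℝ) = q := by
        rw [projIcc_of_mem zero_le_one ⟨hq0, hq1'⟩]
      have := Subtype.coe_le_coe.2 hle
      rw [hval] at this
      exact absurd (hq1.trans_le this) (lt_irrefl _)

/-- **Monotone Borel version, vector-valued**: a measurable `G : Q_d → Q_{d'}` monotone on `λ_d ⊗ λ_d`-almost every
pair agrees `λ_d`-a.e. with a monotone measurable map (coordinatewise envelopes). [this work] -/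
theorem exists_monotone_ae_eq_of_aepair_pi {d' : ℕ} {G : (Fin d → I) → (Fin d' → I)} (hGm : Measurable G)
    (hG : ∀ᵐ p ∂((volume : Measure (Fin d → I)).prod volume), p.1 ≤ p.2 → G p.1 ≤ G p.2) :
    ∃ G' : (Fin d → I) → (Fin d' → I), Monotone G' ∧ Measurable G' ∧ G' =ᵐ[volume] G := by
  have hcoord : ∀ j : Fin d', ∃ g' : (Fin d → I) → I, Monotone g' ∧ Measurable g' ∧
      g' =ᵐ[volume] fun x => G x j := fun j =>
    exists_monotone_ae_eq_of_aepair ((measurable_pi_apply j).comp hGm)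
      (by filter_upwards [hG] with p hp hle using hp hle j)
  choose g' hmono hmeas hae using hcoord
  refine ⟨fun x j => g' j x, fun x y hxy j => hmono j hxy, measurable_pi_iff.2 fun j => hmeas j, ?_⟩
  have h := ae_all_iff.2 hae
  filter_upwards [h] with x hx
  exact funext fun j => hx j

/-- **Push-forwards by a.e.-pair-monotone maps are push-forwards by monotone maps**: if `G : Q_d → Q_{d'}` is
measurable and monotone on almost every pair, there is a monotone measurable `G'` with `G'_* λ_d = G_* λ_d`.
[this work] -/
theorem exists_monotone_map_eq_of_aepair {d' : ℕ} {G : (Fin d → I) → (Fin d' → I)} (hGm : Measurable G)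
    (hG : ∀ᵐ p ∂((volume : Measure (Fin d → I)).prod volume), p.1 ≤ p.2 → G p.1 ≤ G p.2) :
    ∃ G' : (Fin d → I) → (Fin d' → I), Monotone G' ∧ Measurable G' ∧
      (volume : Measure (Fin d → I)).map G' = (volume : Measure (Fin d → I)).map G := by
  obtain ⟨G', hmono, hmeas, hae⟩ := exists_monotone_ae_eq_of_aepair_pi hGm hG
  exact ⟨G', hmono, hmeas, Measure.map_congr hae⟩

end Envelope

end Summit.CriticalPhenomena.PercolationContinuityZ3.Theorems.SahiCIS

end
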